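import Literature.MathematicalPhysics.QuantumFieldTheory.Balaban1983to89.B9Eq3105AtLetters
import Literature.MathematicalPhysics.QuantumFieldTheory.Balaban1983to89.B9CubeBondRowAgreementNearH

/-!
# `Balaban1983to89.B9Eq3105AtLettersNearH` — T. Bałaban, *Propagators for lattice gauge theories in a background field*, Commun. Math. Phys. **99** (1985)
# 389–434 [Balaban1985BackgroundPropagators], (3.105) p. 414 «Δ_aG₀ = I − R» at def-Y's letters with the ROWS-AGREEMENT HYPOTHESIS DISCHARGED by r05's
# `B9CubeBondRowAgreementNearH` (sub-row G-B9-LETTERS, module M5.7 «(3.105) assembly», sequel of `B9Eq3105AtLetters`)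

statement-level skeleton of published theorems with citation tags; proofs where landed; nothing here is a claim about the Yang–Mills mass gap

PDF held: `paper:balaban1985-cmp99-background-propagators` (journal page = PDF page + 388).  p. 414 (3.105): «Δ_aG₀ = I − Σ_□K(h_□)G_□h_□ − Σ_□(1 − ζ_□̃)DPD*h_□G_□h_□ −
Σ_□ζ_□̃(DPD* − DP_□D*)h_□G_□h_□ − Σ_□ζ_□̃P_{□,1}(∂h_□)G_□h_□ = I − R»; p. 409 l.3–5 «The operators constructed for this sequence, which we denote by G′_□(U),
C_□(U) = (Q(U)G′_□²(U)Q*(U))⁻¹, G_□(U), satisfy all the inequalities of Theorems 3.1–3.3 correspondingly»; p. 408 «Ω_n(□) ⊂ Ω_n» (the local sequence agrees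
with the member's near □).

WHAT THIS FILE IS.  `B9Eq3105AtLetters.eq3105_hT_GACubeY` carries the displayed hypothesis `hrow` — the averaging rows of `Δ_{a,□}(U)` and `Δ_a(U)` agree at the
bonds `f` with `h_□(f₋) ≠ 0`; r05's `B9CubeBondRowAgreementNearH.QsaQCubeY_apply_eq_of_hT` proves exactly that from the `NearH` bookkeeping of `supp h^T_□`
(`h_□ = hT`, read at `toBox i.hN f.src = chartY i f.src`, `rfl`).  THIS FILE removes the hypothesis: ★★ `eq3105_hT_GACubeY_of_hT` — (3.105) at the partition of
record and the cube letters `G_□(U) = Δ_{a,□}(U)⁻¹` under ONLY the invertibility of the `Δ_{a,□}(U)` and a choice of cut-offs `ζ_□̃ = 1 on supp h_□`; and the fixed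
point `fixedPoint3105_hT_GACubeY_of_hT`.
HONEST SCOPE.  As the parent file: an identity, no estimate; `IsUnit (Δ_{a,□}(U))` at curved `U` is Thm 3.11's regime for the cube letters (in tree at `U = 1`
only, r05's `isUnit_deltaACubeY_one`) and stays a HYPOTHESIS; nothing continuum ∕ OS ∕ mass gap ∕ Clay; YM mass gap NOT proved by any of this (Track A
conditional rung).  `--supports stmt-QuantumFields-19200`.  Net new unproved facts: 0.
-/

noncomputable section

namespace Literature.MathematicalPhysics.QuantumFieldTheory.Balaban1983to89.B9Eq3105AtLettersNearH

open Node00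
open B9Thm37CubeCoverCommutators (cutMulY hTY)
open B9Eq3104CutoffCommutators (hBdY KhBY DPDsY)
open B9CubeLettersBondOpsL0 (deltaACubeY GACubeY)
open B9CubeBondRowAgreementNearH (QsaQCubeY_apply_eq_of_hT)
open B9Eq3105AtLetters (DPDsCubeY P1CubeY eq3105_hT_GACubeY fixedPoint3105_hT_GACubeY)
open B6KLevelCensusIndexV1 (KIdx)
open B6Cover236MultiLevelBlocks (cubes)
open scoped Matrix

variable {d ℓ : ℕ} {hd : 1 ≤ d + 1} {hL : Odd (ℓ + 1) ∧ 1 < ℓ + 1} {b₀ b₁ : ℝ}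
variable {𝔸 : Type} [NormedRing 𝔸] [NormedAlgebra ℂ 𝔸] [CompleteSpace 𝔸]
variable (i : KIdx d ℓ hd hL b₀ b₁)

/-- ★★ **(3.105) AT def-Y's LETTERS, ROWS AGREEMENT DISCHARGED**: with `h_□ = hTY i □`, `G_□(U) = GACubeY i □ parS parB U`, `DP_□D*(U) = DPDsCubeY i □ parS U`,
`P_{□,1}(∂h_□)(U) = P1CubeY i □ (hTY i □) parS U`, ANY cut-offs `ζ_□̃` with `ζ_□̃ = 1` on `supp h_□`, and every `Δ_{a,□}(U)` invertible:
`Δ_a(U)·Σ_□ h_□G_□(U)h_□ = 1 − Σ_□K(h_□)(U)G_□(U)h_□ − Σ_□(1 − ζ_□̃)DPD*(U)(h_□G_□(U)h_□) − Σ_□ζ_□̃(DPD*(U) − DP_□D*(U))(h_□G_□(U)h_□) − Σ_□ζ_□̃P_{□,1}(∂h_□)(U)G_□(U)h_□`.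
[cite: Balaban1985BackgroundPropagators, (3.105) p.414, (3.87) p.409, p.408 («Σ h_□² = 1», «Ω_n(□) ⊂ Ω_n»), p.409 l.3–5] -/
theorem eq3105_hT_GACubeY_of_hT (parS : SiteParY 𝔸 i) (parB : BondParY 𝔸 i) (Gp : SiteOpY 𝔸 i) (U : CfgY 𝔸 i)
    (ζ : ↥(cubes i.D.toDomains) → SiteY i → ℝ) (hζ : ∀ c z, hTY i c z ≠ 0 → ζ c z = 1)
    (hinv : ∀ c : ↥(cubes i.D.toDomains), IsUnit (deltaACubeY i c parS parB U)) :
    deltaAY i parS parB Gp U * ∑ c, cutMulY (hBdY i (hTY i c)) * GACubeY i c parS parB U * cutMulY (hBdY i (hTY i c)) =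
      1 - ∑ c, KhBY i (hTY i c) parB U * GACubeY i c parS parB U * cutMulY (hBdY i (hTY i c))
        - ∑ c, (1 - cutMulY (hBdY i (ζ c))) * DPDsY i parS Gp U *
            (cutMulY (hBdY i (hTY i c)) * GACubeY i c parS parB U * cutMulY (hBdY i (hTY i c)))
        - ∑ c, cutMulY (hBdY i (ζ c)) * (DPDsY i parS Gp U - DPDsCubeY i c parS U) *
            (cutMulY (hBdY i (hTY i c)) * GACubeY i c parS parB U * cutMulY (hBdY i (hTY i c)))
        - ∑ c, cutMulY (hBdY i (ζ c)) * P1CubeY i c (hTY i c) parS U * GACubeY i c parS parB U * cutMulY (hBdY i (hTY i c)) :=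
  eq3105_hT_GACubeY i parS parB Gp U ζ hζ hinv fun c A f hf => QsaQCubeY_apply_eq_of_hT i c parB U A f hf

/-- ★ the fixed point `G = G₀ + G·R`, rows agreement discharged: ANY left inverse `G` of `Δ_a(U)` equals print's `G₀ = Σ_□ h_□G_□(U)h_□` plus `G·R`, `R` the four
sums of (3.105). [cite: Balaban1985BackgroundPropagators, (3.105)–(3.106) p.414, (3.87) p.409] -/
theorem fixedPoint3105_hT_GACubeY_of_hT (parS : SiteParY 𝔸 i) (parB : BondParY 𝔸 i) (Gp : SiteOpY 𝔸 i) (U : CfgY 𝔸 i)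
    (ζ : ↥(cubes i.D.toDomains) → SiteY i → ℝ) (hζ : ∀ c z, hTY i c z ≠ 0 → ζ c z = 1)
    (hinv : ∀ c : ↥(cubes i.D.toDomains), IsUnit (deltaACubeY i c parS parB U))
    {G : Module.End ℂ (FBondY i → 𝔸)} (hG : G * deltaAY i parS parB Gp U = 1) :
    G = (∑ c, cutMulY (hBdY i (hTY i c)) * GACubeY i c parS parB U * cutMulY (hBdY i (hTY i c)))
      + G * (∑ c, KhBY i (hTY i c) parB U * GACubeY i c parS parB U * cutMulY (hBdY i (hTY i c))
        + ∑ c, (1 - cutMulY (hBdY i (ζ c))) * DPDsY i parS Gp U *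
            (cutMulY (hBdY i (hTY i c)) * GACubeY i c parS parB U * cutMulY (hBdY i (hTY i c)))
        + ∑ c, cutMulY (hBdY i (ζ c)) * (DPDsY i parS Gp U - DPDsCubeY i c parS U) *
            (cutMulY (hBdY i (hTY i c)) * GACubeY i c parS parB U * cutMulY (hBdY i (hTY i c)))
        + ∑ c, cutMulY (hBdY i (ζ c)) * P1CubeY i c (hTY i c) parS U * GACubeY i c parS parB U * cutMulY (hBdY i (hTY i c))) :=
  fixedPoint3105_hT_GACubeY i parS parB Gp U ζ hζ hinv (fun c A f hf => QsaQCubeY_apply_eq_of_hT i c parB U A f hf) hG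

end Literature.MathematicalPhysics.QuantumFieldTheory.Balaban1983to89.B9Eq3105AtLettersNearH

end
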